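import Summits.PneNP.PneNP.Theorems.ChebyshevTracialDesignSpectralNonTightnessWide
import HarnessLib

/-!
# Cell pnp-psdrank, route `ChebyshevTracialDesign`: complement symmetry of the level classes and level weights in `K_m`

Harmonic backbone of the crux `TracialDecayExp20` (stmt-PneNP-19878), brick 48b (prover g10; bookkeeping for the non-tight-free `r = 1` rung,
whose reduced instances may have cut size `t'' > m/2` and are then read on the complements `[m] ∖ U`, cf. brick 29
`…SpectralNonTightnessWide.cc_compl`): for `m` even and `t ≤ m`, `(U, M) ∈ Q_c(t) ↔ (Uᶜ, M) ∈ Q_c(m − t)` (`mem_Qset_compl_iff`),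
`|Q_c(m−t)| = |Q_c(t)|` (`card_Qset_compl`), `levelWeight m (m−t) C w Uᶜ M = levelWeight m t C w U M` (`levelWeight_compl`), and the value of a
rectangle `X × Y` at cut size `t` equals the value of `Xᶜ × Y` at cut size `m − t` (`sum_levelWeight_compl`). [cite: Rothvoss2017, §2 (PDF p. 5: `δ(U) = δ(V ∖ U)`)]
Stature: support/instrument (no defs). WHAT THIS IS NOT: nothing on psd rank, no P-vs-NP content. Supports stmt-PneNP-19878.
-/

set_option linter.dupNamespace false -- `Summit.PneNP.PneNP.…`: summit = sub-problem (D-0017)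

noncomputable section

namespace Summit.PneNP.PneNP.Theorems.ChebyshevTracialDesignLevelWeightCompl

open Finset Literature.Combinatorics.Optimization
open Literature.Barriers.PneNP
open Summit.PneNP.PneNP.Theorems.ChebyshevTracialDesignSpectralNonTightnessWide (cc_compl)

/-- The complement of an odd cut of `K_m` (`m` even) is an odd cut. [folklore] -/
theorem odd_card_compl {m : ℕ} (hm : Even m) (U : OddSet m) : Odd (univ \ U.1).card := by
  rw [card_univ_sdiff, Fintype.card_fin]
  obtain ⟨k, hk⟩ := hm
  obtain ⟨j, hj⟩ := U.2
  have := card_le_univ U.1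
  rw [Fintype.card_fin] at this
  exact ⟨k - j - 1, by omega⟩

/-- `(U, M) ∈ Q_c(t)` iff `(Uᶜ, M) ∈ Q_c(m − t)` (`m` even, `t ≤ m`). [cite: Rothvoss2017, §2 (PDF p. 5)] -/
theorem mem_Qset_compl_iff {m t c : ℕ} (hm : Even m) (htm : t ≤ m) (U : OddSet m) (M : PMatch m) :
    (⟨univ \ U.1, odd_card_compl hm U⟩, M) ∈ Qset m (m - t) c ↔ (U, M) ∈ Qset m t c := by
  rw [mem_Qset_iff, mem_Qset_iff, cc_compl]
  simp only [card_univ_sdiff, Fintype.card_fin]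
  have := card_le_univ U.1
  rw [Fintype.card_fin] at this
  constructor
  · rintro ⟨h1, h2⟩; exact ⟨by omega, h2⟩
  · rintro ⟨h1, h2⟩; exact ⟨by omega, h2⟩

/-- `|Q_c(m − t)| = |Q_c(t)|` in `K_m` (`m` even, `t ≤ m`). [cite: Rothvoss2017, §2 (PDF p. 5)] -/
theorem card_Qset_compl {m t c : ℕ} (hm : Even m) (htm : t ≤ m) : (Qset m (m - t) c).card = (Qset m t c).card := by
  symm
  refine card_bij (fun q _ => (⟨univ \ q.1.1, odd_card_compl hm q.1⟩, q.2)) (fun q hq => ?_) (fun q _ q' _ hqq => ?_) (fun q hq => ?_)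
  · exact (mem_Qset_compl_iff hm htm q.1 q.2).2 (by simpa using hq)
  · simp only [Prod.mk.injEq, Subtype.mk.injEq] at hqq
    obtain ⟨h1, h2⟩ := hqq
    have : q.1.1 = q'.1.1 := by simpa [Finset.sdiff_sdiff_eq_self (subset_univ _)] using congrArg (fun W : Finset (Fin m) => univ \ W) h1
    exact Prod.ext (Subtype.ext this) h2
  · refine ⟨(⟨univ \ q.1.1, odd_card_compl hm q.1⟩, q.2), ?_, ?_⟩
    · have hq' := mem_Qset_iff.1 hq
      rw [mem_Qset_iff, cc_compl]
      simp only [card_univ_sdiff, Fintype.card_fin]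
      have := card_le_univ q.1.1
      rw [Fintype.card_fin] at this
      exact ⟨by omega, hq'.2⟩
    · ext <;> simp [Finset.sdiff_sdiff_eq_self (subset_univ _)]

/-- **Level weights are complement-symmetric**: `levelWeight m t C w U M = levelWeight m (m−t) C w Uᶜ M` (`m` even, `t ≤ m`).
[cite: Rothvoss2017, §2 (PDF p. 5)] -/
theorem levelWeight_compl {m t : ℕ} (hm : Even m) (htm : t ≤ m) (C' : Finset ℕ) (w : ℕ → ℝ) (U : OddSet m) (M : PMatch m) :
    levelWeight m (m - t) C' w ⟨univ \ U.1, odd_card_compl hm U⟩ M = levelWeight m t C' w U M := by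
  unfold levelWeight
  refine sum_congr rfl fun c _ => ?_
  rw [card_Qset_compl hm htm]
  by_cases hq : (U, M) ∈ Qset m t c
  · rw [if_pos hq, if_pos ((mem_Qset_compl_iff hm htm U M).2 hq)]
  · rw [if_neg hq, if_neg (fun h' => hq ((mem_Qset_compl_iff hm htm U M).1 h'))]

/-- **Complementing a reduced rectangle**: the value of `X × Y` at cut size `t` equals the value of `Xᶜ × Y` at cut size `m − t`, where
`Xᶜ = {[m] ∖ U : U ∈ X}` has the same cardinality. [cite: Rothvoss2017, §2 (PDF p. 5)] -/
theorem sum_levelWeight_compl {m t : ℕ} (hm : Even m) (htm : t ≤ m) (C' : Finset ℕ) (w : ℕ → ℝ) (X : Finset (OddSet m))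
    (Y : Finset (PMatch m)) :
    ∑ U ∈ X.image (fun U : OddSet m => (⟨univ \ U.1, odd_card_compl hm U⟩ : OddSet m)), ∑ M ∈ Y, levelWeight m (m - t) C' w U M =
      ∑ U ∈ X, ∑ M ∈ Y, levelWeight m t C' w U M ∧
    (X.image (fun U : OddSet m => (⟨univ \ U.1, odd_card_compl hm U⟩ : OddSet m))).card = X.card := by
  have hinj : Function.Injective (fun U : OddSet m => (⟨univ \ U.1, odd_card_compl hm U⟩ : OddSet m)) := by
    intro U U' hUU'
    have h1 := congrArg (fun W : OddSet m => univ \ W.1) hUU'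
    apply Subtype.ext
    simpa [Finset.sdiff_sdiff_eq_self (subset_univ _)] using h1
  refine ⟨?_, card_image_of_injective _ hinj⟩
  rw [sum_image fun U _ U' _ h => hinj h]
  exact sum_congr rfl fun U _ => sum_congr rfl fun M _ => levelWeight_compl hm htm C' w U M

end Summit.PneNP.PneNP.Theorems.ChebyshevTracialDesignLevelWeightCompl
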